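import Summits.KontsevichZagierPeriods.KontsevichZagierPeriods.Theorems.RootDecompRationalCubeDichotomyNashMultiGenP05

/-! # `RootDecompRationalCubeDichotomyNashMultiGenP06` — part 6/16 of the mechanical ≤385-line split of `NashEtaleMultiGen.lean`
(split by the decomp-kz census seat for landing; mathematics unchanged; part 6 continues part 5). -/

open Set MvPolynomial Filter Topology
open Literature.NumberTheory.Transcendental (IsSemialgebraicFunOn)
open Literature.ModelTheory.ExponentialFields (IsSemialgebraic isSemialgebraic_setOf_eval_pos
  isSemialgebraic_setOf_eval_ne_zero)

namespace Summit.KontsevichZagierPeriods.RootDecompRationalCubeDichotomy.Rung29430.MultiGen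
open Summit.KontsevichZagierPeriods.KontsevichZagierPeriods.Theses.RootDecompRationalCubeDichotomy
  (NashEtaleCover NashEtaleLocal PiRationalisation)
open Summit.KontsevichZagierPeriods.RootDecompRationalCubeDichotomy.Rung29430.NashEtaleLocalGlue
  (local_of_simple nashEtaleCover_of_nashEtaleLocal nashEtaleLocal_zero)
open Summit.KontsevichZagierPeriods.RootDecompRationalCubeDichotomy.Rung29430.NashEtaleLocalOne
  (analyticOnNhd_aeval_snoc)
open Summit.KontsevichZagierPeriods.RootDecompRationalCubeDichotomy.RungEtale.Etale
  (piRationalisation_of_nashEtaleCover)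

noncomputable section

section Transport
open Literature.NumberTheory.Transcendental
variable {n : ℕ}

/-- **Local `ℚ`-Nash inverse of the chart** (from the `ℚ`-Nash implicit function theorem §4e,
applied to the system `T_i(x') − y_i = 0` in `(y, x')`). -/
theorem exists_chart_inverse (x₀ : Fin n → ℝ) (T : Fin n → MvPolynomial (Fin n) ℚ)
    (hdet : (Matrix.of fun i l : Fin n => MvPolynomial.aeval x₀ (pderiv l (T i))).det ≠ 0) :
    ∃ (V : Set (Fin n → ℝ)) (ψ : Fin n → (Fin n → ℝ) → ℝ), IsOpen V ∧ chartMap T x₀ ∈ V ∧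
      (∀ j, ψ j (chartMap T x₀) = x₀ j) ∧ (∀ j, IsSemialgebraicFunOn ℚ V (ψ j)) ∧
      (∀ j, AnalyticOnNhd ℝ (ψ j) V) ∧ ∀ y ∈ V, chartMap T (fun j => ψ j y) = y := by
  classical
  let F : Fin n → MvPolynomial (Fin (n + n)) ℚ :=
    fun i => MvPolynomial.rename (Fin.natAdd n) (T i) - X (Fin.castAdd n i)
  have hFev : ∀ (y x : Fin n → ℝ) (i : Fin n),
      MvPolynomial.aeval (Fin.append y x) (F i) = chartMap T x i - y i := by
    intro y x i
    simp only [F, map_sub, MvPolynomial.aeval_rename, append_comp_natAdd, MvPolynomial.aeval_X,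
      Fin.append_left]
    rfl
  have hF : ∀ i, MvPolynomial.aeval (Fin.append (chartMap T x₀) x₀) (F i) = 0 := by
    intro i
    rw [hFev, sub_self]
  have hpd : ∀ i j, pderiv (Fin.natAdd n j) (F i) =
      MvPolynomial.rename (Fin.natAdd n) (pderiv j (T i)) := by
    intro i j
    simp only [F, map_sub]
    rw [MvPolynomial.pderiv_rename (Fin.natAdd_injective n n), pderiv_X_of_ne, sub_zero]
    intro h
    have := congrArg Fin.val h
    simp at this
    omega
  have hmat : (Matrix.of fun i j : Fin n =>
      MvPolynomial.aeval (Fin.append (chartMap T x₀) x₀) (pderiv (Fin.natAdd n j) (F i))) =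
      Matrix.of fun i l : Fin n => MvPolynomial.aeval x₀ (pderiv l (T i)) := by
    ext i j
    simp only [Matrix.of_apply, hpd, MvPolynomial.aeval_rename, append_comp_natAdd]
  obtain ⟨V, ψ, hVo, hy₀V, hψ₀, hψsa, hψan, hFψ⟩ :=
    NashImplicit.exists_nash_implicit F (chartMap T x₀) x₀ hF (by rw [hmat]; exact hdet)
  refine ⟨V, ψ, hVo, hy₀V, hψ₀, hψsa, hψan, fun y hy => ?_⟩
  funext i
  have := hFψ y hy i
  rw [hFev] at this
  exact sub_eq_zero.mp this

/-- `ψ ∘ Φ_T = id` near `x₀` (local uniqueness of solutions of `T(x') = T(x)` through `(x₀, x₀)`). -/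
theorem chart_leftInverse_near (x₀ : Fin n → ℝ) (T : Fin n → MvPolynomial (Fin n) ℚ)
    (hdet : (Matrix.of fun i l : Fin n => MvPolynomial.aeval x₀ (pderiv l (T i))).det ≠ 0)
    {V : Set (Fin n → ℝ)} {ψ : Fin n → (Fin n → ℝ) → ℝ} (hVo : IsOpen V)
    (hy₀V : chartMap T x₀ ∈ V) (hψ₀ : ∀ j, ψ j (chartMap T x₀) = x₀ j)
    (hψan : ∀ j, AnalyticOnNhd ℝ (ψ j) V) (hψ : ∀ y ∈ V, chartMap T (fun j => ψ j y) = y) :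
    ∃ W : Set (Fin n → ℝ), IsOpen W ∧ x₀ ∈ W ∧ (∀ x ∈ W, chartMap T x ∈ V) ∧
      ∀ x ∈ W, ∀ j, ψ j (chartMap T x) = x j := by
  classical
  let S : Fin n → MvPolynomial (Fin (n + n)) ℚ :=
    fun i => MvPolynomial.rename (Fin.natAdd n) (T i) - MvPolynomial.rename (Fin.castAdd n) (T i)
  have hSev : ∀ (x x' : Fin n → ℝ) (i : Fin n),
      MvPolynomial.aeval (Fin.append x x') (S i) = chartMap T x' i - chartMap T x i := by
    intro x x' i
    simp only [S, map_sub, MvPolynomial.aeval_rename, append_comp_natAdd, append_comp_castAdd]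
    rfl
  have hpd : ∀ i j, pderiv (Fin.natAdd n j) (S i) =
      MvPolynomial.rename (Fin.natAdd n) (pderiv j (T i)) := by
    intro i j
    simp only [S, map_sub]
    rw [MvPolynomial.pderiv_rename (Fin.natAdd_injective n n),
      pderiv_rename_eq_zero (Fin.castAdd n) (Fin.natAdd n j) (fun l h => ?_) (T i), sub_zero]
    have := congrArg Fin.val h
    simp at this
    omega
  have hmat : (Matrix.of fun i j : Fin n =>
      MvPolynomial.aeval (Fin.append x₀ x₀) (pderiv (Fin.natAdd n j) (S i))) =
      Matrix.of fun i l : Fin n => MvPolynomial.aeval x₀ (pderiv l (T i)) := by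
    ext i j
    simp only [Matrix.of_apply, hpd, MvPolynomial.aeval_rename, append_comp_natAdd]
  have hV₀o : IsOpen ((chartMap T) ⁻¹' V) := hVo.preimage (continuous_chartMap T)
  obtain ⟨W, hWo, hx₀W, hWsub, hW⟩ := NashImplicit.solutions_eq_near S x₀ x₀
    (by rw [hmat]; exact hdet) hV₀o (show x₀ ∈ (chartMap T) ⁻¹' V from hy₀V)
    (u := fun j x => x j) (v := fun j x => ψ j (chartMap T x))
    (fun _ => rfl) (fun j => hψ₀ j)
    (fun j => (continuous_apply j).continuousAt)
    (fun j => ContinuousAt.comp (f := chartMap T) ((hψan j _ hy₀V).continuousAt)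
      (continuous_chartMap T).continuousAt)
    (fun x _ i => by rw [hSev]; exact sub_self _)
    (fun x hx i => by rw [hSev, hψ _ hx, sub_self])
  exact ⟨W, hWo, hx₀W, fun x hx => hWsub hx, fun x hx j => (hW x hx j).symm⟩

/-- The substitution `y_l ↦ T_l(x)`, `u_j ↦ u_j` on `ℚ[y, u] = ℚ[Fin (n + k)]`. -/
def substT (k : ℕ) (T : Fin n → MvPolynomial (Fin n) ℚ) :
    Fin (n + k) → MvPolynomial (Fin (n + k)) ℚ :=
  fun v => Fin.addCases (motive := fun _ => MvPolynomial (Fin (n + k)) ℚ)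
    (fun l => MvPolynomial.rename (Fin.castAdd k) (T l)) (fun j => X (Fin.natAdd n j)) v

/-- Auxiliary step `substT_castAdd`. [bookkeeping] -/
@[simp] theorem substT_castAdd (k : ℕ) (T : Fin n → MvPolynomial (Fin n) ℚ) (l : Fin n) :
    substT k T (Fin.castAdd k l) = MvPolynomial.rename (Fin.castAdd k) (T l) := by
  simp [substT]

/-- Auxiliary step `substT_natAdd`. [bookkeeping] -/
@[simp] theorem substT_natAdd (k : ℕ) (T : Fin n → MvPolynomial (Fin n) ℚ) (j : Fin k) :
    substT k T (Fin.natAdd n j) = X (Fin.natAdd n j) := by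
  simp [substT]

/-- Auxiliary step `aeval_bind₁_substT`. [bookkeeping] -/
theorem aeval_bind₁_substT {k : ℕ} (T : Fin n → MvPolynomial (Fin n) ℚ) (x : Fin n → ℝ)
    (w : Fin k → ℝ) (P : MvPolynomial (Fin (n + k)) ℚ) :
    MvPolynomial.aeval (Fin.append x w) (MvPolynomial.bind₁ (substT k T) P) =
      MvPolynomial.aeval (Fin.append (chartMap T x) w) P := by
  have hfun : (fun v => MvPolynomial.aeval (Fin.append x w) (substT k T v)) =
      Fin.append (chartMap T x) w := by
    funext v
    induction v using Fin.addCases with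
    | left l =>
      rw [substT_castAdd, MvPolynomial.aeval_rename, append_comp_castAdd, Fin.append_left]
      rfl
    | right j => simp only [substT_natAdd, MvPolynomial.aeval_X, Fin.append_right]
  rw [MvPolynomial.aeval_bind₁, hfun]

/-- Auxiliary step `pderiv_bind₁_substT`. [bookkeeping] -/
theorem pderiv_bind₁_substT {k : ℕ} (T : Fin n → MvPolynomial (Fin n) ℚ) (j : Fin k)
    (P : MvPolynomial (Fin (n + k)) ℚ) :
    pderiv (Fin.natAdd n j) (MvPolynomial.bind₁ (substT k T) P) =
      MvPolynomial.bind₁ (substT k T) (pderiv (Fin.natAdd n j) P) := by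
  classical
  have hθ : ∀ v, pderiv (Fin.natAdd n j) (substT k T v) =
      MvPolynomial.bind₁ (substT k T) (pderiv (Fin.natAdd n j) (X v)) := by
    intro v
    induction v using Fin.addCases with
    | left l =>
      rw [substT_castAdd, pderiv_rename_eq_zero (Fin.castAdd k) (Fin.natAdd n j)
        (fun i h => ?_) (T l), pderiv_X_of_ne (fun h => ?_), map_zero]
      · have := congrArg Fin.val h
        simp at this
        omega
      · have := congrArg Fin.val h
        simp at this
        omega
    | right j' =>
      rw [substT_natAdd, pderiv_X]
      simp only [Pi.single_apply]
      split_ifs <;> simp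
  induction P using MvPolynomial.induction_on with
  | C a => simp
  | add p q hp hq => simp [hp, hq]
  | mul_X p v hp =>
    simp only [map_mul, MvPolynomial.bind₁_X_right, Derivation.leibniz, smul_eq_mul, map_add,
      hp, hθ]

/-- GERM FORM of piece M at a point: every `ℚ`-Nash germ at `x₀` has many-generator data. -/
def NashGermMultiGen (n : ℕ) (x₀ : Fin n → ℝ) : Prop :=
  ∀ (g : (Fin n → ℝ) → ℝ) (U : Set (Fin n → ℝ)), IsOpen U → x₀ ∈ U →
    IsSemialgebraicFunOn ℚ U g → AnalyticOnNhd ℝ g U → ∃ k, MultiGenData n k g x₀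

/-- PRODUCT POINTS: algebraically independent coordinates on `range e`, `0` elsewhere. -/
def IsProductPoint (y₀ : Fin n → ℝ) : Prop :=
  ∃ (m : ℕ) (e : Fin m → Fin n), Function.Injective e ∧ AlgebraicIndependent ℚ (y₀ ∘ e) ∧
    ∀ j ∉ Set.range e, y₀ j = 0

/-- Piece M at SPECIAL PRODUCT POINTS only (germ form) — what the transport leaves open. -/
def ProductPointMultiGen (n : ℕ) : Prop :=
  ∀ y₀ : Fin n → ℝ, IsProductPoint y₀ → ¬ AlgebraicIndependent ℚ y₀ → NashGermMultiGen n y₀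

/-- **Pull-back of `MultiGenData` along the chart.**  If `G := g ∘ ψ` has many-generator data
at `Φ_T(x₀)` and `ψ ∘ Φ_T = id` on an open `W ∋ x₀`, then `g` has many-generator data at `x₀`:
generators `u_j ∘ Φ_T`, relations / numerator / denominator with `y_l ↦ T_l(x)` substituted. -/
theorem multiGenData_transport {k : ℕ} {g : (Fin n → ℝ) → ℝ} (x₀ : Fin n → ℝ)
    (T : Fin n → MvPolynomial (Fin n) ℚ) {ψ : Fin n → (Fin n → ℝ) → ℝ} {W : Set (Fin n → ℝ)}
    (hWo : IsOpen W) (hx₀W : x₀ ∈ W) (hleft : ∀ x ∈ W, ∀ j, ψ j (chartMap T x) = x j)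
    (hG : MultiGenData n k (fun y => g (fun j => ψ j y)) (chartMap T x₀)) :
    MultiGenData n k g x₀ := by
  classical
  obtain ⟨V₂, u, F, A, B, hV₂o, hy₀V₂, husa, huan, hFu, hJ, hgB⟩ := hG
  have hO : IsOpen (W ∩ (chartMap T) ⁻¹' V₂) :=
    hWo.inter (hV₂o.preimage (continuous_chartMap T))
  obtain ⟨a, b, hx₀B, hBsub⟩ := exists_ratBox_subset hO ⟨hx₀W, hy₀V₂⟩
  refine ⟨ratBox a b, fun j x => u j (chartMap T x), fun i => MvPolynomial.bind₁ (substT k T) (F i),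
    MvPolynomial.bind₁ (substT k T) A, MvPolynomial.bind₁ (substT k T) B, isOpen_ratBox a b,
    hx₀B, ?_, ?_, ?_, ?_, ?_⟩
  · intro j
    have hmap : IsSemialgebraicMapOn ℚ (ratBox a b) (chartMap T) :=
      isSemialgebraicMapOn_aeval (isSemialgebraic_ratBox a b) T
    exact IsSemialgebraicFunOn.comp_isSemialgebraicMapOn_holds (husa j) hmap
      (fun x hx => (hBsub hx).2)
  · intro j x hx
    exact (huan j _ (hBsub hx).2).comp (analyticAt_chartMap T x)
  · intro x hx i
    rw [aeval_bind₁_substT]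
    exact hFu _ (hBsub hx).2 i
  · have hmat : (Matrix.of fun i j : Fin k =>
        MvPolynomial.aeval (Fin.append x₀ fun j => u j (chartMap T x₀))
          (pderiv (Fin.natAdd n j) (MvPolynomial.bind₁ (substT k T) (F i)))) =
        Matrix.of fun i j : Fin k =>
          MvPolynomial.aeval (Fin.append (chartMap T x₀) fun j => u j (chartMap T x₀))
            (pderiv (Fin.natAdd n j) (F i)) := by
      ext i j
      simp only [Matrix.of_apply, pderiv_bind₁_substT, aeval_bind₁_substT]
    rw [hmat]
    exact hJ
  · intro x hx
    rw [aeval_bind₁_substT, aeval_bind₁_substT]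
    have hxg : g x = g (fun j => ψ j (chartMap T x)) := by
      congr 1
      funext j
      exact (hleft x (hBsub hx).1 j).symm
    rw [hxg]
    exact hgB _ (hBsub hx).2

/-- **Transport theorem.**  Piece M at special product points implies the germ form of piece M
at EVERY point of `ℝⁿ`. -/
theorem nashGermMultiGen_of_productPointMultiGen (h : ProductPointMultiGen n) (x₀ : Fin n → ℝ) :
    NashGermMultiGen n x₀ := by
  classical
  intro g U hU hx₀U hsa han
  obtain ⟨m, e, T, he, hind, hTe, hT⟩ := exists_generic_chart x₀
  have hdet := det_chart_ne_zero x₀ e T hTe (fun j hj => ⟨(hT j hj).2.1, (hT j hj).2.2⟩)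
  obtain ⟨V, ψ, hVo, hy₀V, hψ₀, hψsa, hψan, hψ⟩ := exists_chart_inverse x₀ T hdet
  obtain ⟨W, hWo, hx₀W, -, hleft⟩ := chart_leftInverse_near x₀ T hdet hVo hy₀V hψ₀ hψan hψ
  -- `G := g ∘ ψ` on a rational box `∋ Φ_T(x₀)` inside `V ∩ ψ⁻¹ U`
  have hψv_cont : ContinuousOn (fun y j => ψ j y) V :=
    continuousOn_pi.2 fun j => (hψan j).continuousOn
  have hψv₀ : (fun j => ψ j (chartMap T x₀)) = x₀ := funext hψ₀
  have hO : IsOpen (V ∩ (fun y j => ψ j y) ⁻¹' U) := hψv_cont.isOpen_inter_preimage hVo hU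
  obtain ⟨a, b, hy₀B, hBsub⟩ := exists_ratBox_subset hO
    ⟨hy₀V, show (fun j => ψ j (chartMap T x₀)) ∈ U by rw [hψv₀]; exact hx₀U⟩
  have hGsa : IsSemialgebraicFunOn ℚ (ratBox a b) (fun y => g (fun j => ψ j y)) := by
    have hmap : IsSemialgebraicMapOn ℚ (ratBox a b) (fun y j => ψ j y) :=
      IsSemialgebraicMapOn.of_forall (isSemialgebraic_ratBox a b) fun j =>
        (hψsa j).mono (fun y hy => (hBsub hy).1) (isSemialgebraic_ratBox a b)
    exact IsSemialgebraicFunOn.comp_isSemialgebraicMapOn_holds hsa hmap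
      (fun y hy => (hBsub hy).2)
  have hGan : AnalyticOnNhd ℝ (fun y => g (fun j => ψ j y)) (ratBox a b) := by
    intro y hy
    have hψvan : AnalyticAt ℝ (fun y j => ψ j y) y := AnalyticAt.pi fun j => hψan j y (hBsub hy).1
    exact (han _ (hBsub hy).2).comp hψvan
  by_cases hgen : AlgebraicIndependent ℚ (chartMap T x₀)
  · exact ⟨1, multiGenData_transport x₀ T hWo hx₀W hleft
      (multiGenData_of_algebraicIndependent (isOpen_ratBox a b) hGsa hGan hy₀B hgen)⟩
  · have hce : chartMap T x₀ ∘ e = x₀ ∘ e := by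
      funext i
      simp [Function.comp, chartMap, hTe]
    have hprod : IsProductPoint (chartMap T x₀) :=
      ⟨m, e, he, by rw [hce]; exact hind, fun j hj => (hT j hj).1⟩
    obtain ⟨k, hG⟩ := h _ hprod hgen (fun y => g (fun j => ψ j y)) (ratBox a b)
      (isOpen_ratBox a b) hy₀B hGsa hGan
    exact ⟨k, multiGenData_transport x₀ T hWo hx₀W hleft hG⟩

/-- Auxiliary step `productPointMultiGen_of_nashGerm`. [bookkeeping] -/
theorem productPointMultiGen_of_nashGerm (h : ∀ x₀ : Fin n → ℝ, NashGermMultiGen n x₀) :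
    ProductPointMultiGen n :=
  fun y₀ _ _ => h y₀

/-- Net: piece M at special product points ↔ the germ form of piece M everywhere. -/
theorem productPointMultiGen_iff :
    ProductPointMultiGen n ↔ ∀ x₀ : Fin n → ℝ, NashGermMultiGen n x₀ :=
  ⟨nashGermMultiGen_of_productPointMultiGen, productPointMultiGen_of_nashGerm⟩

/-- … hence piece M on the cube. -/
theorem multiGenAt_of_productPointMultiGen (h : ProductPointMultiGen n) : MultiGenAt n :=
  fun g U hU hKU hsa han x₀ hx₀ =>
    nashGermMultiGen_of_productPointMultiGen h x₀ g U hU (hKU hx₀) hsa han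

/-- **Germ ⟸ cube.**  Piece M on the unit cube already gives the germ form of piece M at EVERY
point of `ℝⁿ`: blow a small rational box `∏ (a'_i, b'_i) ∋ x₀` up onto a neighbourhood of the
closed unit cube by the rational affine map `y ↦ a' + (b' − a')·y` and transport back along the
affine chart `x ↦ (x − a')/(b' − a')` (`multiGenData_transport`).  Hence all forms of piece M are
EQUIVALENT: `ProductPointMultiGen n ↔ MultiGenAt n ↔ NashEtaleLocalAt n`. -/
theorem nashGermMultiGen_of_multiGenAt (hM : MultiGenAt n) (x₀ : Fin n → ℝ) :
    NashGermMultiGen n x₀ := by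
  classical
  intro g U hU hx₀U hsa han
  obtain ⟨a, b, hx₀ab, habU⟩ := exists_ratBox_subset hU hx₀U
  have hx₀i : ∀ i, (a i : ℝ) < x₀ i ∧ x₀ i < b i := fun i => hx₀ab i (Set.mem_univ i)
  have ha' : ∀ i, ∃ q : ℚ, (a i : ℝ) < q ∧ (q : ℝ) < x₀ i := fun i => exists_rat_btwn (hx₀i i).1
  have hb' : ∀ i, ∃ q : ℚ, x₀ i < q ∧ (q : ℝ) < b i := fun i => exists_rat_btwn (hx₀i i).2
  choose a' ha'a ha'x using ha'
  choose b' hb'x hb'b using hb'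
  -- lengths `L i = b' i − a' i > 0` and their rational inverses `c i`
  have hLpos : ∀ i, (0 : ℝ) < (b' i : ℝ) - a' i := fun i => sub_pos.mpr ((ha'x i).trans (hb'x i))
  let c : Fin n → ℚ := fun i => (b' i - a' i)⁻¹
  have hcR : ∀ i, (c i : ℝ) = ((b' i : ℝ) - a' i)⁻¹ := fun i => by simp [c]
  have hcpos : ∀ i, (0 : ℝ) < c i := fun i => by rw [hcR]; exact inv_pos.mpr (hLpos i)
  have hc : ∀ i, ((b' i : ℝ) - a' i) * (c i : ℝ) = 1 := fun i => by
    rw [hcR, mul_inv_cancel₀ (ne_of_gt (hLpos i))]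
  have hcancel : ∀ i (t : ℝ), ((b' i : ℝ) - a' i) * ((c i : ℝ) * t) = t := fun i t => by
    rw [← mul_assoc, hc i, one_mul]
  -- the affine chart `T` (`x ↦ c·(x − a')`) and its inverse `S` (`y ↦ a' + (b' − a')·y`)
  let T : Fin n → MvPolynomial (Fin n) ℚ := fun i => C (c i) * (X i - C (a' i))
  let S : Fin n → MvPolynomial (Fin n) ℚ := fun j => C (a' j) + (C (b' j) - C (a' j)) * X j
  have hT : ∀ (x : Fin n → ℝ) i, chartMap T x i = (c i : ℝ) * (x i - a' i) := by
    intro x i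
    simp only [chartMap, T, map_mul, map_sub, MvPolynomial.aeval_C, MvPolynomial.aeval_X,
      eq_ratCast]
  have hS : ∀ (y : Fin n → ℝ) j, MvPolynomial.aeval y (S j) = (a' j : ℝ) + ((b' j : ℝ) - a' j) * y j := by
    intro y j
    simp only [S, map_add, map_mul, map_sub, MvPolynomial.aeval_C, MvPolynomial.aeval_X,
      eq_ratCast]
  have hleft : ∀ x ∈ (Set.univ : Set (Fin n → ℝ)), ∀ j,
      MvPolynomial.aeval (chartMap T x) (S j) = x j := by
    intro x _ j
    rw [hS, hT, hcancel]
    ring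
  -- the rescaled germ `G = g ∘ S` is `ℚ`-Nash near the closed unit cube
  let U' : Set (Fin n → ℝ) := ratBox (fun i => c i * (a i - a' i)) (fun i => c i * (b i - a' i))
  have hmaps : ∀ y ∈ U', (fun j => MvPolynomial.aeval y (S j)) ∈ ratBox a b := by
    intro y hy j _
    have hyj := hy j (Set.mem_univ j)
    simp only [Rat.cast_mul, Rat.cast_sub, Set.mem_Ioo] at hyj
    show MvPolynomial.aeval y (S j) ∈ Set.Ioo ((a j : ℝ)) (b j)
    rw [hS, Set.mem_Ioo]
    constructor
    · have h1 := mul_lt_mul_of_pos_left hyj.1 (hLpos j)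
      rw [hcancel] at h1
      linarith
    · have h1 := mul_lt_mul_of_pos_left hyj.2 (hLpos j)
      rw [hcancel] at h1
      linarith
  have hcube : Set.pi Set.univ (fun _ : Fin n => Set.Icc (0 : ℝ) 1) ⊆ U' := by
    intro y hy j _
    have hyj := hy j (Set.mem_univ j)
    simp only [Set.mem_Icc] at hyj
    simp only [Rat.cast_mul, Rat.cast_sub, Set.mem_Ioo]
    constructor
    · have : (c j : ℝ) * (a j - a' j) < 0 :=
        mul_neg_of_pos_of_neg (hcpos j) (sub_neg.mpr (ha'a j))
      linarith
    · have h2 : (c j : ℝ) * ((b' j : ℝ) - a' j) < c j * (b j - a' j) :=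
        mul_lt_mul_of_pos_left (by linarith [hb'b j]) (hcpos j)
      rw [mul_comm, hc j] at h2
      linarith
  have hGsa : IsSemialgebraicFunOn ℚ U' (fun y => g (fun j => MvPolynomial.aeval y (S j))) :=
    IsSemialgebraicFunOn.comp_isSemialgebraicMapOn_holds
      (hsa.mono habU (isSemialgebraic_ratBox a b))
      (isSemialgebraicMapOn_aeval (isSemialgebraic_ratBox _ _) S) hmaps
  have hGan : AnalyticOnNhd ℝ (fun y => g (fun j => MvPolynomial.aeval y (S j))) U' := by
    intro y hy
    exact (han _ (habU (hmaps y hy))).comp (analyticAt_chartMap S y)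
  -- `y₀ = T(x₀)` lies in the closed cube
  have hy₀ : chartMap T x₀ ∈ Set.pi Set.univ (fun _ : Fin n => Set.Icc (0 : ℝ) 1) := by
    intro i _
    rw [hT]
    refine ⟨(mul_pos (hcpos i) (sub_pos.mpr (ha'x i))).le, ?_⟩
    have h2 : (c i : ℝ) * (x₀ i - a' i) < c i * ((b' i : ℝ) - a' i) :=
      mul_lt_mul_of_pos_left (by linarith [hb'x i]) (hcpos i)
    rw [mul_comm (c i : ℝ) ((b' i : ℝ) - a' i), hc i] at h2
    exact h2.le
  obtain ⟨k, hG⟩ := hM _ U' (isOpen_ratBox _ _) hcube hGsa hGan _ hy₀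
  exact ⟨k, multiGenData_transport x₀ T isOpen_univ (Set.mem_univ _) hleft hG⟩

/-- All typed forms of piece M are EQUIVALENT (v4): product points ↔ germ ↔ cube. -/
theorem productPointMultiGen_iff_multiGenAt : ProductPointMultiGen n ↔ MultiGenAt n :=
  ⟨multiGenAt_of_productPointMultiGen,
    fun h => productPointMultiGen_of_nashGerm (nashGermMultiGen_of_multiGenAt h)⟩

end Transport

/-! ## §4c  Piece C — the collapse `CollapseAt n`, PROVED for every `n` (Stacks 00UE)

`k` étale generators collapse to one: the `ℚ[x]`-algebra `S' = ℚ[x][y₁..y_k, z]/(F₁..F_k, z·J − 1)`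
(`J` the Jacobian determinant) is standard smooth of relative dimension `0`, hence étale; at the
prime `Q` = kernel of the point character at `(x₀, u(x₀), 1/J)` Mathlib's
`Algebra.IsEtaleAt.exists_isStandardEtale` (Stacks 00UE) gives a standard étale presentation
`ℚ[x][X]_g/(f)` of a localisation `S'_b`, `b(x₀,…) ≠ 0`; its generator, read through the point
characters along the graph of `u`, is the sought `ℚ`-Nash function `h`, with `f(x,h) = 0`,
`f'(x,h) ≠ 0` and `g = p_A(x,h)/p_B(x,h)` after clearing powers of the unit `g(x,h)`.  This is the
g7 `collapse₁_holds` construction (n = 1, k = 2) in general `(n, k)`. -/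

end
end Summit.KontsevichZagierPeriods.RootDecompRationalCubeDichotomy.Rung29430.MultiGen
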